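import Summits.RiemannHypothesis.RiemannHypothesis.Theorems.JensenLogBandArcDensityDeriv
import Summits.RiemannHypothesis.RiemannHypothesis.Theorems.JensenLogBandArcSaddleCurvature
import Literature.NumberTheory.LFunctions.Zhang2022.Section4Lemma45
import HarnessLib

/-!
# Main term versus translated-saddle model, I: the density factor ([CMP], near zone of the BAND crux)

RH ladder column JENSEN, rung J-P(P3) «log band», BAND crux `XiDerivBandRealAllRates`
(stmt-RiemannHypothesis-19913) of route «JensenLogBand», line «band-one-window» (top-shell reshape,
BAND lead rh-jensen-prover g8; the lead's ASK [CMP] of STATUS 2026-08-27T05:38:24Z, plan of eng-2 g6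
05:50:34Z). RH-FREE calculus of explicit model functions. WHAT THIS IS NOT: nothing here bears on
zeros of `ζ` off the line or the truth of RH.

The ratio `Main(c, u*)/M̃_{c₀,u₀}(c)` of the Laplace main term `LogBandArc.arcMainTerm n c u*` to the
shifted model `LogBandArc.arcShiftModel n c₀ u₀ c` is a product of three factors close to `1` (density,
`ζ`, curvature). This file supplies the elementary lemmas and the DENSITY factor:

* `norm_mul_mul_sub_one_le` — `‖xyz − 1‖ ≤ (1+a)(1+b)(1+c) − 1`;
* `norm_cpow_half_sub_cpow_half_le`, `norm_sqrt_pi_div_sub_le` — principal square roots of nearby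
  points of the right half-plane: `‖(π/w)^{1/2} − (π/w₀)^{1/2}‖ ≤ √2·(‖w − w₀‖/‖w‖)·‖(π/w₀)^{1/2}‖`;
* `disc_good_point`, `hasDerivAt_arcSaddleFn_norm_le`, `differentiableOn_arcDensity_ball` — on the
  closed `(3/5)h`-disc about `c + h`: good points, `‖S′‖ ≤ M_S := 33/(4T) + 1/(0.79T)² + (n+1)/(1.79T)²
  + 25n/(4h²)`, holomorphy of the density `P_{n,c}` on the open disc;
* **`arcDensity_saddle_eq_mul_exp`** — `P_c(u*) = P_c(ũ)·exp(E)` with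
  `E = (u* − ũ)∫₀¹ S_c(ũ + x(u* − ũ))dx` (`Zhang2022.Lemma45.eq_mul_exp_integral_logDeriv_segment`, `P′/P = S`
  by `LogBandArc.hasDerivAt_arcDensity`) and `‖E‖ ≤ M_S·d²` for `‖u* − ũ‖ ≤ d ≤ h/5`, because `S_c(u*) = 0`.

(prover-rh-jensen-eng-2-g7-0, 2026-08-27.)
-/

noncomputable section

-- single-problem summit: `Summit.RiemannHypothesis.RiemannHypothesis.…` is the tree convention
set_option linter.dupNamespace false

open Complex Real Set Metric
open scoped Interval

namespace Summit.RiemannHypothesis.RiemannHypothesis.Theorems.JensenPolynomials.LogBandArc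

open Literature.NumberTheory.LFunctions

/-! ## Three elementary lemmas -/

/-- `‖xyz − 1‖ ≤ (1+a)(1+b)(1+c) − 1` when `‖x − 1‖ ≤ a`, `‖y − 1‖ ≤ b`, `‖z − 1‖ ≤ c`. [folklore] -/
theorem norm_mul_mul_sub_one_le {x y z : ℂ} {a b c : ℝ} (hx : ‖x - 1‖ ≤ a) (hy : ‖y - 1‖ ≤ b)
    (hz : ‖z - 1‖ ≤ c) : ‖x * y * z - 1‖ ≤ (1 + a) * (1 + b) * (1 + c) - 1 := by
  have ha : 0 ≤ a := (norm_nonneg _).trans hx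
  have hb : 0 ≤ b := (norm_nonneg _).trans hy
  have hc : 0 ≤ c := (norm_nonneg _).trans hz
  have hny : ‖y‖ ≤ 1 + b := by
    have := norm_add_le (y - 1) 1; rw [sub_add_cancel, norm_one] at this; linarith
  have hnz : ‖z‖ ≤ 1 + c := by
    have := norm_add_le (z - 1) 1; rw [sub_add_cancel, norm_one] at this; linarith
  have e : x * y * z - 1 = (x - 1) * (y * z) + ((y - 1) * z + (z - 1)) := by ring
  rw [e]
  have h1 : ‖(x - 1) * (y * z)‖ ≤ a * ((1 + b) * (1 + c)) := by
    rw [norm_mul, norm_mul]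
    exact mul_le_mul hx (mul_le_mul hny hnz (norm_nonneg _) (by linarith)) (by positivity) ha
  have h2 : ‖(y - 1) * z‖ ≤ b * (1 + c) := by
    rw [norm_mul]; exact mul_le_mul hy hnz (norm_nonneg _) hb
  calc ‖(x - 1) * (y * z) + ((y - 1) * z + (z - 1))‖
      ≤ ‖(x - 1) * (y * z)‖ + (‖(y - 1) * z‖ + ‖z - 1‖) :=
        (norm_add_le _ _).trans (add_le_add le_rfl (norm_add_le _ _))
    _ ≤ a * ((1 + b) * (1 + c)) + (b * (1 + c) + c) := by linarith
    _ = (1 + a) * (1 + b) * (1 + c) - 1 := by ring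

/-- **Principal square roots of nearby points.** For `Re z₀ > 0` and any `z`:
`‖z^{1/2} − z₀^{1/2}‖ ≤ √2 · (‖z − z₀‖/‖z₀‖) · ‖z₀^{1/2}‖`
(`(Q − Q₀)(Q + Q₀) = z − z₀` and `Re(Q + Q₀) ≥ Re Q₀ ≥ (‖z₀‖/2)^{1/2}`). [folklore] -/
theorem norm_cpow_half_sub_cpow_half_le {z z₀ : ℂ} (hz₀ : 0 < z₀.re) :
    ‖z ^ (1 / 2 : ℂ) - z₀ ^ (1 / 2 : ℂ)‖ ≤ Real.sqrt 2 * (‖z - z₀‖ / ‖z₀‖) * ‖z₀ ^ (1 / 2 : ℂ)‖ := by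
  have e12 : (1 / 2 : ℂ) = (2 : ℂ)⁻¹ := one_div 2
  rw [e12]
  set Q : ℂ := z ^ (2 : ℂ)⁻¹ with hQdef
  set Q₀ : ℂ := z₀ ^ (2 : ℂ)⁻¹ with hQ₀def
  have hQ : Q ^ 2 = z := Complex.cpow_ofNat_inv_pow z 2
  have hQ₀ : Q₀ ^ 2 = z₀ := Complex.cpow_ofNat_inv_pow z₀ 2
  have hz₀0 : z₀ ≠ 0 := fun h => by rw [h] at hz₀; simp at hz₀
  have hnz₀ : 0 < ‖z₀‖ := norm_pos_iff.2 hz₀0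
  have hReQ : 0 ≤ Q.re := by rw [hQdef, Complex.cpow_inv_two_re]; exact Real.sqrt_nonneg _
  have hReQ₀ : Real.sqrt (‖z₀‖ / 2) ≤ Q₀.re := by
    rw [hQ₀def, Complex.cpow_inv_two_re]; exact Real.sqrt_le_sqrt (by linarith)
  have hsq0 : 0 < Real.sqrt (‖z₀‖ / 2) := Real.sqrt_pos.2 (by positivity)
  set s : ℝ := Real.sqrt ‖z₀‖ with hsdef
  have hs0 : 0 < s := Real.sqrt_pos.2 hnz₀
  have hs2 : s ^ 2 = ‖z₀‖ := Real.sq_sqrt hnz₀.le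
  have hnQ₀ : ‖Q₀‖ = s := by
    have h2 : ‖Q₀‖ ^ 2 = ‖z₀‖ := by rw [← norm_pow, hQ₀]
    rw [hsdef, ← h2, Real.sqrt_sq (norm_nonneg _)]
  have hhalf : Real.sqrt (‖z₀‖ / 2) = s / Real.sqrt 2 := by
    rw [hsdef]; exact Real.sqrt_div' _ (by norm_num)
  have hsum : Real.sqrt (‖z₀‖ / 2) ≤ ‖Q + Q₀‖ := by
    have := Complex.re_le_norm (Q + Q₀)
    rw [Complex.add_re] at this; linarith
  have hprod : (Q - Q₀) * (Q + Q₀) = z - z₀ := by rw [← hQ, ← hQ₀]; ring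
  have hnorm : ‖Q - Q₀‖ * ‖Q + Q₀‖ = ‖z - z₀‖ := by rw [← norm_mul, hprod]
  have h1 : ‖Q - Q₀‖ ≤ ‖z - z₀‖ / Real.sqrt (‖z₀‖ / 2) := by
    rw [le_div_iff₀ hsq0]
    calc ‖Q - Q₀‖ * Real.sqrt (‖z₀‖ / 2) ≤ ‖Q - Q₀‖ * ‖Q + Q₀‖ :=
          mul_le_mul_of_nonneg_left hsum (norm_nonneg _)
      _ = ‖z - z₀‖ := hnorm
  have h2 : ‖z - z₀‖ / Real.sqrt (‖z₀‖ / 2) = Real.sqrt 2 * (‖z - z₀‖ / ‖z₀‖) * ‖Q₀‖ := by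
    rw [hhalf, hnQ₀, ← hs2]
    have hsqrt2 : (0 : ℝ) < Real.sqrt 2 := Real.sqrt_pos.2 (by norm_num)
    field_simp
  rw [← h2]; exact h1

/-- **The curvature square roots.** For `w, w₀` in the open right half-plane:
`‖(π/w)^{1/2} − (π/w₀)^{1/2}‖ ≤ √2 · (‖w − w₀‖/‖w‖) · ‖(π/w₀)^{1/2}‖`. [folklore] -/
theorem norm_sqrt_pi_div_sub_le {w w₀ : ℂ} (hw : 0 < w.re) (hw₀ : 0 < w₀.re) :
    ‖((π : ℂ) / w) ^ (1 / 2 : ℂ) - ((π : ℂ) / w₀) ^ (1 / 2 : ℂ)‖ ≤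
      Real.sqrt 2 * (‖w - w₀‖ / ‖w‖) * ‖((π : ℂ) / w₀) ^ (1 / 2 : ℂ)‖ := by
  have hw0 : w ≠ 0 := fun h => by rw [h] at hw; simp at hw
  have hw₀0 : w₀ ≠ 0 := fun h => by rw [h] at hw₀; simp at hw₀
  have hπ : (0 : ℝ) < π := Real.pi_pos
  have hre : 0 < ((π : ℂ) / w₀).re := by
    rw [Complex.div_re, Complex.ofReal_re, Complex.ofReal_im, zero_mul, zero_div, add_zero]
    exact div_pos (mul_pos hπ hw₀) (Complex.normSq_pos.2 hw₀0)
  have h := norm_cpow_half_sub_cpow_half_le (z := (π : ℂ) / w) hre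
  have hq : ‖(π : ℂ) / w - (π : ℂ) / w₀‖ / ‖(π : ℂ) / w₀‖ = ‖w - w₀‖ / ‖w‖ := by
    have e : (π : ℂ) / w - (π : ℂ) / w₀ = (π : ℂ) * (w₀ - w) / (w * w₀) := by
      rw [div_sub_div _ _ hw0 hw₀0]; ring
    rw [e, norm_div, norm_div, norm_mul, norm_mul, Complex.norm_real, Real.norm_eq_abs,
      abs_of_pos hπ, norm_sub_rev]
    have hnw : 0 < ‖w‖ := norm_pos_iff.2 hw0
    have hnw₀ : 0 < ‖w₀‖ := norm_pos_iff.2 hw₀0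
    field_simp
  rw [hq] at h
  exact h


/-! ## Good points of the disc and the size of `S′` there -/

section disc

variable {n : ℕ} {x T : ℝ} {z : ℂ}

/-- Points of the closed `(3/5)h`-disc about `c + h` are good points for the density and the saddle
function: `Re(½+z) > 0`, `½ + z ≠ 1`, `z ≠ 0`, `z ≠ c`, `z + c ≠ 0`, and `‖z − c‖ ≥ (2/5)h`.
[folklore] -/
theorem disc_good_point (hx : |x| ≤ 1 / 2) (hT : 100 ≤ T) (hh : 1 / 2 ≤ bandRadius n T)
    (hhT : bandRadius n T ≤ 7 / 20 * T)
    (hz : ‖z - ((x : ℂ) + (T : ℂ) * I + bandRadius n T)‖ ≤ 3 / 5 * bandRadius n T) :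
    0 < (1 / 2 + z).re ∧ 1 / 2 + z ≠ 1 ∧ z ≠ 0 ∧ z ≠ ((x : ℂ) + (T : ℂ) * I) ∧
      z + ((x : ℂ) + (T : ℂ) * I) ≠ 0 ∧
      2 / 5 * bandRadius n T ≤ ‖z - ((x : ℂ) + (T : ℂ) * I)‖ := by
  obtain ⟨him_lo, -, hre_lo, -, -, -, hnu_lo, -, -, hnuc⟩ := disc_geometry hx hT hh hhT hz
  have hT0 : 0 < T := by linarith
  have hh0 : 0 < bandRadius n T := by linarith
  have hzc : 2 / 5 * bandRadius n T ≤ ‖z - ((x : ℂ) + (T : ℂ) * I)‖ := by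
    have h1 := norm_sub_norm_le ((bandRadius n T : ℝ) : ℂ)
      (((x : ℂ) + (T : ℂ) * I + bandRadius n T) - z)
    have e : ((bandRadius n T : ℝ) : ℂ) - (((x : ℂ) + (T : ℂ) * I + bandRadius n T) - z) =
        z - ((x : ℂ) + (T : ℂ) * I) := by ring
    rw [e, Complex.norm_real, Real.norm_eq_abs, abs_of_pos hh0, norm_sub_rev] at h1
    linarith
  refine ⟨by linarith, ?_, ?_, ?_, ?_, hzc⟩
  · intro h1
    have e : (1 / 2 + z).im = (1 : ℂ).im := by rw [h1]
    simp at e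
    have e2 : (1 / 2 + z).im = z.im := by simp
    rw [e2, e] at him_lo
    linarith
  · intro h0; rw [h0, norm_zero] at hnu_lo; linarith
  · intro h0; rw [h0, sub_self, norm_zero] at hzc; linarith
  · intro h0; rw [h0, norm_zero] at hnuc; linarith

/-- **`‖S′‖` on the disc:** `‖S′_{n,c}(z)‖ ≤ 33/(4T) + 1/(0.79T)² + (n+1)/(1.79T)² + 25n/(4h²)` at every
point of the closed `(3/5)h`-disc (`S′ = D′ + n/(z−c)²`, `‖z − c‖ ≥ (2/5)h`). [folklore] -/
theorem hasDerivAt_arcSaddleFn_norm_le (hx : |x| ≤ 1 / 2) (hT : 100 ≤ T) (hℓ : 20 ≤ ell T)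
    (hn : 100 ≤ n) (hh : 1 / 2 ≤ bandRadius n T) (hhT : bandRadius n T ≤ 7 / 20 * T)
    (hz : ‖z - ((x : ℂ) + (T : ℂ) * I + bandRadius n T)‖ ≤ 3 / 5 * bandRadius n T) :
    HasDerivAt (arcSaddleFn n ((x : ℂ) + (T : ℂ) * I))
        (deriv (arcSaddleFn n ((x : ℂ) + (T : ℂ) * I)) z) z ∧
      ‖deriv (arcSaddleFn n ((x : ℂ) + (T : ℂ) * I)) z‖ ≤
        33 / 4 / T + 1 / (79 / 100 * T) ^ 2 + ((n : ℝ) + 1) / (179 / 100 * T) ^ 2 +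
          25 * n / (4 * bandRadius n T ^ 2) := by
  obtain ⟨D', hD', hb⟩ := hasDerivAt_arcSaddleFn hx hT hℓ hn hh hhT hz
  obtain ⟨-, -, -, -, -, hzc⟩ := disc_good_point hx hT hh hhT hz
  have hh0 : 0 < bandRadius n T := by linarith
  refine ⟨hD'.differentiableAt.hasDerivAt, ?_⟩
  rw [hD'.deriv]
  have hfrac : ‖(n : ℂ) / (z - ((x : ℂ) + (T : ℂ) * I)) ^ 2‖ ≤ 25 * n / (4 * bandRadius n T ^ 2) := by
    rw [norm_div, Complex.norm_natCast, norm_pow]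
    have hpos : 0 < (2 / 5 * bandRadius n T) ^ 2 := by positivity
    have hsq : (2 / 5 * bandRadius n T) ^ 2 ≤ ‖z - ((x : ℂ) + (T : ℂ) * I)‖ ^ 2 :=
      pow_le_pow_left₀ (by positivity) hzc 2
    calc (n : ℝ) / ‖z - ((x : ℂ) + (T : ℂ) * I)‖ ^ 2 ≤ (n : ℝ) / (2 / 5 * bandRadius n T) ^ 2 :=
          div_le_div_of_nonneg_left (by positivity) hpos hsq
      _ = 25 * n / (4 * bandRadius n T ^ 2) := by field_simp; ring
  calc ‖D' + (n : ℂ) / (z - ((x : ℂ) + (T : ℂ) * I)) ^ 2‖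
      ≤ ‖D'‖ + ‖(n : ℂ) / (z - ((x : ℂ) + (T : ℂ) * I)) ^ 2‖ := norm_add_le _ _
    _ ≤ _ := by linarith

/-- The density `P_{n,c}` is holomorphic on the OPEN `(3/5)h`-disc about `c + h`. [folklore] -/
theorem differentiableOn_arcDensity_ball (hx : |x| ≤ 1 / 2) (hT : 100 ≤ T)
    (hh : 1 / 2 ≤ bandRadius n T) (hhT : bandRadius n T ≤ 7 / 20 * T) :
    DifferentiableOn ℂ (arcDensity n ((x : ℂ) + (T : ℂ) * I))
      (ball (((x : ℂ) + (T : ℂ) * I) + bandRadius n T) (3 / 5 * bandRadius n T)) := by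
  intro z hz
  rw [mem_ball, dist_eq_norm] at hz
  obtain ⟨hre, h1, hz0, hzc, hzpc, -⟩ := disc_good_point hx hT hh hhT hz.le
  exact (hasDerivAt_arcDensity n hre h1 hz0 hzc hzpc).differentiableAt.differentiableWithinAt

end disc

/-! ## The density factor: `P_c(u*) = P_c(ũ)·exp(E)`, `‖E‖ ≤ M_S d²` -/

section density

variable {n : ℕ} {x T : ℝ} {u ut : ℂ}

set_option maxHeartbeats 400000 in -- long chain of explicit estimates in a large context, no search
/-- **The density factor.** In regime R2 at the centre `c = x + iT` with saddle `u*` (`S_{n,c}(u*) = 0`),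
for every point `ũ` with `‖u* − ũ‖ ≤ d ≤ h/5`:
`P_c(u*) = P_c(ũ)·exp(E)` with `E = (u* − ũ)∫₀¹ S_c(ũ + x(u* − ũ))dx` and
`‖E‖ ≤ (33/(4T) + 1/(0.79T)² + (n+1)/(1.79T)² + 25n/(4h²))·d²` (the segment lies in the disc, `S_c(u*) = 0`
and `‖S′‖ ≤ M_S` there). [folklore] -/
theorem arcDensity_saddle_eq_mul_exp (hx : |x| ≤ 1 / 2) (hT : 100 ≤ T) (hℓ : 20 ≤ ell T)
    (hn : 100 ≤ n) (hh : 1 / 2 ≤ bandRadius n T) (hhT : bandRadius n T ≤ 7 / 20 * T)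
    (hH : bandRadius n T ≤ 20)
    (hu : ‖u - ((x : ℂ) + (T : ℂ) * I + bandRadius n T)‖ ≤ 3 / 5 * bandRadius n T)
    (hS : arcSaddleFn n ((x : ℂ) + (T : ℂ) * I) u = 0) {d : ℝ} (hut : ‖u - ut‖ ≤ d)
    (hd : d ≤ bandRadius n T / 5) :
    ∃ E : ℂ, arcDensity n ((x : ℂ) + (T : ℂ) * I) u =
        arcDensity n ((x : ℂ) + (T : ℂ) * I) ut * Complex.exp E ∧
      ‖E‖ ≤ (33 / 4 / T + 1 / (79 / 100 * T) ^ 2 + ((n : ℝ) + 1) / (179 / 100 * T) ^ 2 +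
          25 * n / (4 * bandRadius n T ^ 2)) * d ^ 2 := by
  obtain ⟨-, hεh, -, -, -⟩ := R2_bookkeeping hT hℓ hh hH
  have hε := norm_arcSaddle_sub_center_sub_radius_le hx hT hℓ hn hh hhT hH hu hS
  have hd0 : 0 ≤ d := (norm_nonneg _).trans hut
  generalize hc : ((x : ℂ) + (T : ℂ) * I) = c at *
  set h : ℝ := bandRadius n T with hhdef
  have hh0 : 0 < h := by linarith
  set M : ℝ := 33 / 4 / T + 1 / (79 / 100 * T) ^ 2 + ((n : ℝ) + 1) / (179 / 100 * T) ^ 2 +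
    25 * n / (4 * h ^ 2) with hM
  set K : Set ℂ := closedBall (c + h) (3 / 5 * h) with hK
  have hmemK : ∀ {w : ℂ}, w ∈ K ↔ ‖w - (c + h)‖ ≤ 3 / 5 * h := by
    intro w; rw [hK, mem_closedBall, dist_eq_norm]
  set S : ℂ → ℂ := arcSaddleFn n c with hSdef
  -- `‖S′‖ ≤ M` on `K`, hence `S` is `M`-Lipschitz there
  have hderiv : ∀ w ∈ K, HasDerivWithinAt S (deriv S w) K w := by
    intro w hw
    have := (hasDerivAt_arcSaddleFn_norm_le hx hT hℓ hn hh hhT (by rw [hc]; exact hmemK.1 hw)).1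
    rw [hc] at this
    exact this.hasDerivWithinAt
  have hbound : ∀ w ∈ K, ‖deriv S w‖ ≤ M := by
    intro w hw
    have := (hasDerivAt_arcSaddleFn_norm_le hx hT hℓ hn hh hhT (by rw [hc]; exact hmemK.1 hw)).2
    rw [hc] at this
    exact this
  have huK : u ∈ K := hmemK.2 hu
  -- the segment `ũ + t(u* − ũ)` lies in the open disc
  have hseg : ∀ t ∈ Icc (0 : ℝ) 1, ‖ut + (t : ℂ) * (u - ut) - (c + h)‖ < 3 / 5 * h := by
    intro t ht
    have e : ut + (t : ℂ) * (u - ut) - (c + h) = (u - (c + h)) - (((1 - t : ℝ)) : ℂ) * (u - ut) := by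
      push_cast; ring
    rw [e]
    have h1 : ‖(((1 - t : ℝ)) : ℂ) * (u - ut)‖ ≤ d := by
      rw [norm_mul, Complex.norm_real, Real.norm_eq_abs, abs_of_nonneg (by linarith [ht.2])]
      calc (1 - t) * ‖u - ut‖ ≤ 1 * ‖u - ut‖ :=
            mul_le_mul_of_nonneg_right (by linarith [ht.1]) (norm_nonneg _)
        _ ≤ d := by rw [one_mul]; exact hut
    calc ‖u - (c + ↑h) - (((1 - t : ℝ)) : ℂ) * (u - ut)‖
        ≤ ‖u - (c + ↑h)‖ + ‖(((1 - t : ℝ)) : ℂ) * (u - ut)‖ := norm_sub_le _ _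
      _ ≤ (2 + 16 / 5 * h) / ell T + d := add_le_add hε h1
      _ < 3 / 5 * h := by linarith
  -- analyticity and non-vanishing of the density along the segment
  have hdiff : DifferentiableOn ℂ (arcDensity n c) (ball (c + h) (3 / 5 * h)) := by
    have := differentiableOn_arcDensity_ball (n := n) hx hT hh hhT
    rw [hc] at this; exact this
  have hg : ∀ t ∈ Icc (0 : ℝ) 1, AnalyticAt ℂ (arcDensity n c) (ut + t * (u - ut)) := by
    intro t ht
    have hmem : ut + (t : ℂ) * (u - ut) ∈ ball (c + h) (3 / 5 * h) := by
      rw [mem_ball, dist_eq_norm]; exact hseg t ht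
    exact hdiff.analyticAt (isOpen_ball.mem_nhds hmem)
  have hgood : ∀ t ∈ Icc (0 : ℝ) 1, 0 < (1 / 2 + (ut + (t : ℂ) * (u - ut))).re ∧
      1 / 2 + (ut + (t : ℂ) * (u - ut)) ≠ 1 ∧ ut + (t : ℂ) * (u - ut) ≠ 0 ∧
      ut + (t : ℂ) * (u - ut) ≠ c ∧ ut + (t : ℂ) * (u - ut) + c ≠ 0 := by
    intro t ht
    have hz : ‖ut + (t : ℂ) * (u - ut) - (((x : ℂ) + (T : ℂ) * I) + bandRadius n T)‖ ≤
        3 / 5 * bandRadius n T := by rw [hc]; exact (hseg t ht).le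
    obtain ⟨h1, h2, h3, h4, h5, -⟩ := disc_good_point hx hT hh hhT hz
    rw [hc] at h4 h5
    exact ⟨h1, h2, h3, h4, h5⟩
  have h0 : ∀ t ∈ Icc (0 : ℝ) 1, arcDensity n c (ut + t * (u - ut)) ≠ 0 := by
    intro t ht
    obtain ⟨h1, h2, h3, h4, h5⟩ := hgood t ht
    exact arcDensity_ne_zero n h1 h2 h3 h4 h5
  -- the segment representation
  have hZ := Zhang2022.Lemma45.eq_mul_exp_integral_logDeriv_segment hg h0
  have hquot : ∀ t ∈ Icc (0 : ℝ) 1, deriv (arcDensity n c) (ut + t * (u - ut)) /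
      arcDensity n c (ut + t * (u - ut)) = S (ut + t * (u - ut)) := by
    intro t ht
    obtain ⟨h1, h2, h3, h4, h5⟩ := hgood t ht
    rw [(hasDerivAt_arcDensity n h1 h2 h3 h4 h5).deriv, mul_div_cancel_left₀ _ (h0 t ht)]
  have hint : ∫ t in (0 : ℝ)..1, deriv (arcDensity n c) (ut + t * (u - ut)) /
      arcDensity n c (ut + t * (u - ut)) = ∫ t in (0 : ℝ)..1, S (ut + t * (u - ut)) := by
    apply intervalIntegral.integral_congr
    intro t ht
    rw [uIcc_of_le zero_le_one] at ht
    exact hquot t ht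
  refine ⟨(u - ut) * ∫ t in (0 : ℝ)..1, S (ut + t * (u - ut)), ?_, ?_⟩
  · rw [← hint, ← hZ]; congr 1; ring
  · -- `‖S(z_t)‖ = ‖S(z_t) − S(u*)‖ ≤ M‖z_t − u*‖ ≤ M d`
    have hptw : ∀ t ∈ Ι (0 : ℝ) 1, ‖S (ut + t * (u - ut))‖ ≤ M * d := by
      intro t ht
      rw [uIoc_of_le zero_le_one] at ht
      have ht' : t ∈ Icc (0 : ℝ) 1 := ⟨ht.1.le, ht.2⟩
      have hzK : ut + (t : ℂ) * (u - ut) ∈ K := hmemK.2 (hseg t ht').le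
      have hLip := (convex_closedBall _ _).norm_image_sub_le_of_norm_hasDerivWithin_le
        hderiv hbound huK hzK
      have hSu : S u = 0 := hS
      rw [hSu, sub_zero] at hLip
      have hdist : ‖ut + (t : ℂ) * (u - ut) - u‖ ≤ d := by
        have e : ut + (t : ℂ) * (u - ut) - u = -((((1 - t : ℝ)) : ℂ) * (u - ut)) := by
          push_cast; ring
        rw [e, norm_neg, norm_mul, Complex.norm_real, Real.norm_eq_abs,
          abs_of_nonneg (by linarith [ht.2])]
        calc (1 - t) * ‖u - ut‖ ≤ 1 * ‖u - ut‖ :=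
              mul_le_mul_of_nonneg_right (by linarith [ht.1]) (norm_nonneg _)
          _ ≤ d := by rw [one_mul]; exact hut
      have hM0 : 0 ≤ M := (norm_nonneg _).trans (hbound u huK)
      exact hLip.trans (mul_le_mul_of_nonneg_left hdist hM0)
    have hI := intervalIntegral.norm_integral_le_of_norm_le_const hptw
    rw [sub_zero, abs_one, mul_one] at hI
    rw [norm_mul]
    have hM0 : 0 ≤ M * d := by
      have : 0 ≤ M := (norm_nonneg _).trans (hbound u huK)
      positivity
    calc ‖u - ut‖ * ‖∫ t in (0 : ℝ)..1, S (ut + t * (u - ut))‖ ≤ d * (M * d) :=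
          mul_le_mul hut hI (norm_nonneg _) hd0
      _ = M * d ^ 2 := by ring

end density


end Summit.RiemannHypothesis.RiemannHypothesis.Theorems.JensenPolynomials.LogBandArc

end
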